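import Summits.KontsevichZagierPeriods.KontsevichZagierPeriods.Theorems.PlanarK0Injective.Negative.Kit

/-!
# `PlanarK0Injective` (stmt-KontsevichZagierPeriods-9847): negative side — V. orientation is not load-bearing

Refuter `cdisprove` (gen 2, cycle 2). `parabola_mirror_mem_orientedChangeOfVariablesRel`: the chiral pair
`{0<x<1, 0<y<x²}` / `{0<x<1, 0<y<(1−x)²}` differs by ONE change-of-variables move whose Jacobian
determinant is `+1` everywhere (`Φ(x,y) = (1−x, x²−y)`: rotation by `π` about `(½,½)` then a vertical
shear), recorded in the finer set `orientedChangeOfVariablesRel ⊆ KZ.changeOfVariablesRel`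
(rule 2 with `det = 1` instead of `|det| = 1`). So orientation / chirality is no invariant of the planar
set-chain group and the `|·|` in `|det Φ'| = 1` is not load-bearing for this pair — on paper for no pair
of subgraph cells (same rotation-plus-shear trick), information for provers: chains may be taken
oriented. Companion of `OneMove.lean` (compactness / preconnectedness ARE one-move invariants).
[Kontsevich–Zagier 2001, §1.2]
-/

noncomputable section

open MeasureTheory Set MvPolynomial
open Literature.NumberTheory.Transcendental Literature.ModelTheory.ExponentialFields

namespace Summit.KontsevichZagierPeriods.SymplecticScissors.PlanarK0InjectiveNegative

open Summit.KontsevichZagierPeriods.KontsevichZagierPeriods.Theses.SymplecticScissors (PlanarK0Injective)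

/-! ## §7 Orientation is not load-bearing: the mirror pair is ONE oriented move -/

/-- The ORIENTED change-of-variables instances: rule 2 with `det Φ' = 1` (not merely `|det| = 1`). [folklore] -/
def orientedChangeOfVariablesRel : Set KZ.FormalRep :=
  {c | ∃ (n : ℕ) (r r' : KZ.IntegralRep n) (Φ : (Fin n → ℝ) → (Fin n → ℝ))
      (Φ' : (Fin n → ℝ) → (Fin n → ℝ) →L[ℝ] (Fin n → ℝ)),
    IsSemialgebraicMapOn ℚ r.domain Φ ∧ (∀ x ∈ r.domain, HasFDerivWithinAt Φ (Φ' x) r.domain x) ∧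
    InjOn Φ r.domain ∧ r'.domain = Φ '' r.domain ∧
    (∀ x ∈ r.domain, r.integrand x = r'.integrand (Φ x) * |(Φ' x).det|) ∧
    (∀ x ∈ r.domain, (Φ' x).det = 1) ∧ c = KZ.of r - KZ.of r'}

/-- Oriented instances are instances. [folklore] -/
theorem orientedChangeOfVariablesRel_subset : orientedChangeOfVariablesRel ⊆ KZ.changeOfVariablesRel := by
  rintro c ⟨n, r, r', Φ, Φ', h1, h2, h3, h4, h5, -, h7⟩
  exact ⟨n, r, r', Φ, Φ', h1, h2, h3, h4, h5, h7⟩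

/-- The curvilinear triangle under the parabola: `{0 < x < 1, 0 < y < x²}`. [folklore] -/
def parabolaSet : Set (Fin 2 → ℝ) := {p | 0 < p 0 ∧ p 0 < 1 ∧ 0 < p 1 ∧ p 1 < p 0 ^ 2}

/-- Its mirror image in the line `x = ½`: `{0 < x < 1, 0 < y < (1 − x)²}`. [folklore] -/
def mirrorParabolaSet : Set (Fin 2 → ℝ) := {p | 0 < p 0 ∧ p 0 < 1 ∧ 0 < p 1 ∧ p 1 < (1 - p 0) ^ 2}

/-- Auxiliary: `isSemialgebraic_parabolaSet`. [folklore] -/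
theorem isSemialgebraic_parabolaSet : IsSemialgebraic ℚ parabolaSet := by
  have h := (((isSemialgebraic_setOf_eval_lt (k := ℚ) (R := ℝ) (ι := Fin 2) (C 0) (X 0)).inter
    (isSemialgebraic_setOf_eval_lt (k := ℚ) (R := ℝ) (ι := Fin 2) (X 0) (C 1))).inter
    (isSemialgebraic_setOf_eval_lt (k := ℚ) (R := ℝ) (ι := Fin 2) (C 0) (X 1))).inter
    (isSemialgebraic_setOf_eval_lt (k := ℚ) (R := ℝ) (ι := Fin 2) (X 1) (X 0 ^ 2))
  have hEq : parabolaSet =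
      (({x : Fin 2 → ℝ | aeval x (C 0 : MvPolynomial (Fin 2) ℚ) < aeval x (X 0 : MvPolynomial (Fin 2) ℚ)} ∩
      {x : Fin 2 → ℝ | aeval x (X 0 : MvPolynomial (Fin 2) ℚ) < aeval x (C 1 : MvPolynomial (Fin 2) ℚ)}) ∩
      {x : Fin 2 → ℝ | aeval x (C 0 : MvPolynomial (Fin 2) ℚ) < aeval x (X 1 : MvPolynomial (Fin 2) ℚ)}) ∩
      {x : Fin 2 → ℝ | aeval x (X 1 : MvPolynomial (Fin 2) ℚ) < aeval x (X 0 ^ 2 : MvPolynomial (Fin 2) ℚ)} := by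
    ext p
    simp [parabolaSet, and_assoc]
  rw [hEq]; exact h

/-- Auxiliary: `isSemialgebraic_mirrorParabolaSet`. [folklore] -/
theorem isSemialgebraic_mirrorParabolaSet : IsSemialgebraic ℚ mirrorParabolaSet := by
  have h := (((isSemialgebraic_setOf_eval_lt (k := ℚ) (R := ℝ) (ι := Fin 2) (C 0) (X 0)).inter
    (isSemialgebraic_setOf_eval_lt (k := ℚ) (R := ℝ) (ι := Fin 2) (X 0) (C 1))).inter
    (isSemialgebraic_setOf_eval_lt (k := ℚ) (R := ℝ) (ι := Fin 2) (C 0) (X 1))).inter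
    (isSemialgebraic_setOf_eval_lt (k := ℚ) (R := ℝ) (ι := Fin 2) (X 1) ((C 1 - X 0) ^ 2))
  have hEq : mirrorParabolaSet =
      (({x : Fin 2 → ℝ | aeval x (C 0 : MvPolynomial (Fin 2) ℚ) < aeval x (X 0 : MvPolynomial (Fin 2) ℚ)} ∩
      {x : Fin 2 → ℝ | aeval x (X 0 : MvPolynomial (Fin 2) ℚ) < aeval x (C 1 : MvPolynomial (Fin 2) ℚ)}) ∩
      {x : Fin 2 → ℝ | aeval x (C 0 : MvPolynomial (Fin 2) ℚ) < aeval x (X 1 : MvPolynomial (Fin 2) ℚ)}) ∩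
      {x : Fin 2 → ℝ | aeval x (X 1 : MvPolynomial (Fin 2) ℚ) <
        aeval x ((C 1 - X 0) ^ 2 : MvPolynomial (Fin 2) ℚ)} := by
    ext p
    simp [mirrorParabolaSet, and_assoc]
  rw [hEq]; exact h

/-- Auxiliary: `parabolaSet_subset_Icc`. [folklore] -/
theorem parabolaSet_subset_Icc : parabolaSet ⊆ Icc (0 : Fin 2 → ℝ) 1 := by
  rintro p ⟨h0, h1, h2, h3⟩
  have hsq : p 0 ^ 2 < 1 := by nlinarith
  refine ⟨fun i => ?_, fun i => ?_⟩ <;> fin_cases i <;> simp <;> linarith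

/-- Auxiliary: `mirrorParabolaSet_subset_Icc`. [folklore] -/
theorem mirrorParabolaSet_subset_Icc : mirrorParabolaSet ⊆ Icc (0 : Fin 2 → ℝ) 1 := by
  rintro p ⟨h0, h1, h2, h3⟩
  have hsq : (1 - p 0) ^ 2 < 1 := by nlinarith
  refine ⟨fun i => ?_, fun i => ?_⟩ <;> fin_cases i <;> simp <;> linarith

/-- Auxiliary: `volume_Icc01_lt_top`. [folklore] -/
theorem volume_Icc01_lt_top : volume (Icc (0 : Fin 2 → ℝ) 1) < ⊤ := isCompact_Icc.measure_lt_top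

/-- The parabola region as a planar set. [folklore] -/
def parabolaRep : KZ.IntegralRep 2 where
  domain := parabolaSet
  integrand := fun _ => 1
  isSemialgebraic_domain := isSemialgebraic_parabolaSet
  isSemialgebraicFunOn_integrand := isSemialgebraicFunOn_one isSemialgebraic_parabolaSet
  integrableOn := integrableOn_const
    ((measure_mono parabolaSet_subset_Icc).trans_lt volume_Icc01_lt_top).ne

/-- The mirrored parabola region as a planar set. [folklore] -/
def mirrorParabolaRep : KZ.IntegralRep 2 where
  domain := mirrorParabolaSet
  integrand := fun _ => 1
  isSemialgebraic_domain := isSemialgebraic_mirrorParabolaSet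
  isSemialgebraicFunOn_integrand := isSemialgebraicFunOn_one isSemialgebraic_mirrorParabolaSet
  integrableOn := integrableOn_const
    ((measure_mono mirrorParabolaSet_subset_Icc).trans_lt volume_Icc01_lt_top).ne

/-- The oriented polynomial move `Φ(x, y) = (1 − x, x² − y)` (rotation by `π` about `(½, ½)`
followed by the shear `(x, y) ↦ (x, y − 1 + (1 − x)²)`; `det DΦ = (−1)(−1) = 1`). [folklore] -/
def mirrorMap : (Fin 2 → ℝ) → (Fin 2 → ℝ) := fun p => ![1 - p 0, p 0 ^ 2 - p 1]

/-- Coordinate projections of the plane as continuous linear forms. [folklore] -/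
abbrev pr (i : Fin 2) : (Fin 2 → ℝ) →L[ℝ] ℝ := ContinuousLinearMap.proj (R := ℝ) (φ := fun _ : Fin 2 => ℝ) i

/-- Its derivative at `p`: `v ↦ (−v₀, 2 p₀ v₀ − v₁)`. [folklore] -/
def mirrorMapDeriv (p : Fin 2 → ℝ) : (Fin 2 → ℝ) →L[ℝ] (Fin 2 → ℝ) :=
  ContinuousLinearMap.pi ![-(pr 0), (2 * p 0) • pr 0 - pr 1]

/-- Auxiliary: `mirrorMapDeriv_apply`. [folklore] -/
theorem mirrorMapDeriv_apply (p v : Fin 2 → ℝ) :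
    mirrorMapDeriv p v = ![-v 0, 2 * p 0 * v 0 - v 1] := by
  ext i
  fin_cases i <;> simp [mirrorMapDeriv, mul_assoc, sub_eq_add_neg]

/-- Auxiliary: `hasFDerivAt_mirrorMap_fst`. [folklore] -/
theorem hasFDerivAt_mirrorMap_fst (p : Fin 2 → ℝ) :
    HasFDerivAt (fun q : Fin 2 → ℝ => 1 - q 0) (-(pr 0)) p := by
  simpa using ((pr 0).hasFDerivAt (x := p)).const_sub 1

/-- Auxiliary: `hasFDerivAt_mirrorMap_snd`. [folklore] -/
theorem hasFDerivAt_mirrorMap_snd (p : Fin 2 → ℝ) :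
    HasFDerivAt (fun q : Fin 2 → ℝ => q 0 ^ 2 - q 1) ((2 * p 0) • pr 0 - pr 1) p := by
  have h := (((pr 0).hasFDerivAt (x := p)).pow 2).sub ((pr 1).hasFDerivAt (x := p))
  refine h.congr_fderiv ?_
  ext v
  simp [two_mul, add_mul]

/-- Auxiliary: `hasFDerivAt_mirrorMap`. [folklore] -/
theorem hasFDerivAt_mirrorMap (p : Fin 2 → ℝ) : HasFDerivAt mirrorMap (mirrorMapDeriv p) p := by
  rw [hasFDerivAt_pi']
  refine Fin.forall_fin_two.mpr ⟨?_, ?_⟩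
  · have e : -(pr 0) = (pr 0).comp (mirrorMapDeriv p) := by
      ext v; simp [mirrorMapDeriv]
    exact (hasFDerivAt_mirrorMap_fst p).congr_fderiv e
  · have e : (2 * p 0) • pr 0 - pr 1 = (pr 1).comp (mirrorMapDeriv p) := by
      ext v; simp [mirrorMapDeriv]
    exact (hasFDerivAt_mirrorMap_snd p).congr_fderiv e

/-- Auxiliary: `det_mirrorMapDeriv`. [folklore] -/
theorem det_mirrorMapDeriv (p : Fin 2 → ℝ) : (mirrorMapDeriv p).det = 1 := by
  have h : (mirrorMapDeriv p : (Fin 2 → ℝ) →ₗ[ℝ] (Fin 2 → ℝ)) =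
      Matrix.toLin' !![(-1 : ℝ), 0; 2 * p 0, -1] := by
    apply LinearMap.ext
    intro v
    rw [ContinuousLinearMap.coe_coe, mirrorMapDeriv_apply, Matrix.toLin'_apply]
    ext i
    fin_cases i <;> simp [Matrix.mulVec, dotProduct, Fin.sum_univ_two, sub_eq_add_neg]
  rw [ContinuousLinearMap.det, h, LinearMap.det_toLin', Matrix.det_fin_two]
  simp

/-- Auxiliary: `isSemialgebraicMapOn_mirrorMap`. [folklore] -/
theorem isSemialgebraicMapOn_mirrorMap {s : Set (Fin 2 → ℝ)} (hs : IsSemialgebraic ℚ s) :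
    IsSemialgebraicMapOn ℚ s mirrorMap := by
  refine (isSemialgebraicMapOn_aeval hs ![C 1 - X 0, X 0 ^ 2 - X 1]).congr fun p _ => ?_
  ext j
  fin_cases j <;> simp [mirrorMap]

/-- Auxiliary: `mirrorMap_apply`. [folklore] -/
theorem mirrorMap_apply (p : Fin 2 → ℝ) : mirrorMap p = ![1 - p 0, p 0 ^ 2 - p 1] := rfl

/-- Auxiliary: `injective_mirrorMap` (indeed an involution up to the shear). [folklore] -/
theorem injective_mirrorMap : Function.Injective mirrorMap := by
  intro p q h
  have h0 := congrFun h 0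
  have h1 := congrFun h 1
  simp [mirrorMap] at h0 h1
  rw [h0] at h1
  ext i
  fin_cases i
  · simpa using h0
  · simp; linarith

/-- Auxiliary: `image_mirrorMap_parabolaSet`. [folklore] -/
theorem image_mirrorMap_parabolaSet : mirrorMap '' parabolaSet = mirrorParabolaSet := by
  ext q
  constructor
  · rintro ⟨p, ⟨h0, h1, h2, h3⟩, rfl⟩
    refine ⟨?_, ?_, ?_, ?_⟩ <;> simp [mirrorMap] <;> nlinarith
  · rintro ⟨h0, h1, h2, h3⟩
    refine ⟨![1 - q 0, (1 - q 0) ^ 2 - q 1], ⟨?_, ?_, ?_, ?_⟩, ?_⟩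
    · simp; linarith
    · simp; linarith
    · simp; linarith
    · simp
      linarith
    · rw [mirrorMap_apply]
      ext i
      fin_cases i <;> simp

/-- **ORIENTATION IS NOT LOAD-BEARING (calibration).** The parabola region `{0<x<1, 0<y<x²}`
and its mirror image `{0<x<1, 0<y<(1−x)²}` differ by ONE change-of-variables move whose map is
a polynomial with rational coefficients and Jacobian determinant `+1` everywhere
(`Φ(x,y) = (1 − x, x² − y)` = rotation by `π` then a vertical shear). So reflections (`det = −1`)
are dispensable for this chiral pair; on paper the same rotation-plus-shear trick turns EVERY
mirror image of a subgraph cell into an oriented move, so chirality is no invariant and the `|·|`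
in `|det Φ'| = 1` is (conjecturally) never needed between planar sets. [folklore] -/
theorem parabola_mirror_mem_orientedChangeOfVariablesRel :
    KZ.of parabolaRep - KZ.of mirrorParabolaRep ∈ orientedChangeOfVariablesRel :=
  ⟨2, parabolaRep, mirrorParabolaRep, mirrorMap, mirrorMapDeriv,
    isSemialgebraicMapOn_mirrorMap isSemialgebraic_parabolaSet,
    fun p _ => (hasFDerivAt_mirrorMap p).hasFDerivWithinAt, injective_mirrorMap.injOn,
    image_mirrorMap_parabolaSet.symm, fun p _ => by simp [parabolaRep, mirrorParabolaRep, det_mirrorMapDeriv],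
    fun p _ => det_mirrorMapDeriv p, rfl⟩

/-- Hence the chiral pair is congruent in the planar set-chain group by one oriented move. [folklore] -/
theorem parabola_mirror_mem_planarGroup :
    KZ.of parabolaRep - KZ.of mirrorParabolaRep ∈ planarGroup :=
  AddSubgroup.subset_closure ⟨Or.inr (orientedChangeOfVariablesRel_subset
      parabola_mirror_mem_orientedChangeOfVariablesRel),
    (AddSubgroup.closure planarGens).sub_mem (AddSubgroup.subset_closure ⟨_, fun _ _ => rfl, rfl⟩)
      (AddSubgroup.subset_closure ⟨_, fun _ _ => rfl, rfl⟩)⟩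

end Summit.KontsevichZagierPeriods.SymplecticScissors.PlanarK0InjectiveNegative
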